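import Literature.Probability.RandomPlanarGeometry.SLEPointFlowStop
import Literature.Probability.RandomPlanarGeometry.LoewnerCentredFlowIntegral
import Literature.Probability.Process.ItoIntegralStopping
import Literature.Probability.Process.ItoIntegralLocality
import HarnessLib

/-!
# The localized SLE_κ point flow is an Itô process; the finite-variation factors `1/Y` and `ψ^a`

Topic `Probability/RandomPlanarGeometry`; step S3b of the discharge of Rohde–Schramm's Lemma 6.3
(`κ < 8`; named fact `Literature.Probability.RandomPlanarGeometry.exists_tendsto_sleDerivRatio_of_lt_eight`).
For `z ∈ ℍ` and the localizing stopping time `ρₙ = slePointLocTime κ z n` (`SLEPointFlow.lean`),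
with the stopped processes `X = x^{ρₙ}`, `Y = y^{ρₙ}` and truncated coefficients of
`SLEPointFlowStop.lean`, we prove, on the canonical space with the raw Brownian filtration:

* `slePointReStop_eq` — **pathwise integrated Loewner equation for `X`**:
  `X_t = re z + ∫₀ᵗ 𝟙_{s≤ρₙ} 2X_s/Q_s ds - W_{t∧ρₙ}` (from `Loewner.re_centredMap_eq`);
* `isItoProcess_slePointReStop` — **`X` is an Itô process** driven by the canonical Brownian
  motion, with drift `𝟙_{s≤ρₙ} 2X/Q` and diffusion coefficient `𝟙_{s≤ρₙ}(-√κ)`: the stochastic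
  term is the square-integrable Itô integral of the truncated constant, indistinguishable from
  `-√κ B^{ρₙ}` (`IsItoIntegral.ae_eq_stoppedProcess`, Revuz–Yor IV (2.5)). This is
  "`dxₜ = 2xₜ|zₜ|⁻² dt - dξ(t)`" (Rohde–Schramm (2005), p. 907) localized before `ρₙ`;
* `inv_slePointImStop_eq` — `1/Y_t = 1/im z + ∫₀ᵗ 𝟙_{s≤ρₙ} 2/(Y_s Q_s) ds`
  (from `Loewner.inv_im_centredMap_eq`);
* `slePointRatioPow κ z n a t ω = exp(a ∫₀ᵗ 𝟙_{s≤ρₙ} 4Y²/Q² ds)` — the factor `ψ_{t∧ρₙ}^a` of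
  Rohde–Schramm's observable, **equal to `(derivRatio)^a` at the stopped clock** by (6.3)
  (`slePointRatioPow_eq_rpow`), adapted with continuous paths, bounded (`1 ≤ · ≤ exp(a Cₙ (n+1))`
  for `a ≥ 0`), and satisfying `ψ^a_t = 1 + ∫₀ᵗ a · rate · ψ^a ds` (`slePointRatioPow_eq_one_add`).

## References

* S. Rohde, O. Schramm, *Basic properties of SLE*, Ann. of Math. 161 (2005), proof of Lemma 6.3
  (pp. 904–905, eqs. (6.3), (6.4)) and of Lemma 6.5 (p. 907).
* D. Revuz, M. Yor, *Continuous Martingales and Brownian Motion* (1999), Ch. IV, Prop. (2.5),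
  Prop. (2.10)(ii); Ch. IX, Def. (1.2).
-/

noncomputable section

open Set Filter MeasureTheory Metric Complex
open _root_.Topology
open scoped NNReal ENNReal

namespace Literature.Probability.RandomPlanarGeometry

open Loewner Literature.Probability.Process Literature.Analysis.FunctionSpaces

variable {κ : ℝ≥0} {z : ℂ} {n : ℕ}

/-! ### Truncated time integrals up to the stopped clock -/

/-- On `[0, u]` with `↑u ≤ ρₙ ω`, the truncated path is the path. [folklore] -/
theorem trunc_locTime_toNNReal_eq_of_le {G : ℝ≥0 → (ℝ≥0 → ℝ) → ℝ} {ω : ℝ≥0 → ℝ} {u : ℝ≥0}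
    (hu : (u : WithTop ℝ≥0) ≤ slePointLocTime κ z n ω) {s : ℝ} (hs : s ∈ Icc (0 : ℝ) u) :
    trunc (slePointLocTime κ z n) G s.toNNReal ω = G s.toNNReal ω :=
  trunc_of_le ((WithTop.coe_le_coe.2 (Real.toNNReal_le_iff_le_coe.2 hs.2)).trans hu)

/-- Real times in `[0, u]`, `↑u ≤ ρₙ ω`, read in `ℝ≥0`, are `≤ ρₙ ω`. [folklore] -/
theorem toNNReal_le_locTime_of_mem {ω : ℝ≥0 → ℝ} {u : ℝ≥0}
    (hu : (u : WithTop ℝ≥0) ≤ slePointLocTime κ z n ω) {s : ℝ} (hs : s ∈ Icc (0 : ℝ) u) :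
    ((s.toNNReal : ℝ≥0) : WithTop ℝ≥0) ≤ slePointLocTime κ z n ω :=
  (WithTop.coe_le_coe.2 (Real.toNNReal_le_iff_le_coe.2 hs.2)).trans hu

/-- `‖zₛ‖² = Q_s` before `ρₙ`. [folklore] -/
theorem norm_centredMap_sq_eq (hz : 0 < z.im) {ω : ℝ≥0 → ℝ} {s : ℝ≥0}
    (hs : (s : WithTop ℝ≥0) ≤ slePointLocTime κ z n ω) :
    ‖centredMap (sleDriving κ ω) s z‖ ^ 2 = slePointNormSqStop κ z n s ω := by
  rw [slePointNormSqStop_eq_of_le hz hs, Complex.normSq_eq_norm_sq]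

/-! ### `X` in integrated form; `X` is an Itô process -/

/-- **Pathwise integrated Loewner equation for `X`**: for every `ω` and `t`,
`X_t = re z + ∫₀ᵗ 𝟙_{s ≤ ρₙ} 2X_s/Q_s ds - W_{t ∧ ρₙ}` (`Loewner.re_centredMap_eq` at the stopped
clock `t ∧ ρₙ < τ(z)`). [cite: RohdeSchramm2005, Lemma 6.5 (proof)] -/
theorem slePointReStop_eq (hz : 0 < z.im) (t : ℝ≥0) (ω : ℝ≥0 → ℝ) :
    slePointReStop κ z n t ω = z.re + timeIntegral (slePointReDrift κ z n) t ω -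
      sleDriving κ ω ((min (t : WithTop ℝ≥0) (slePointLocTime κ z n ω)).untopA) := by
  set u : ℝ≥0 := (min (t : WithTop ℝ≥0) (slePointLocTime κ z n ω)).untopA with hu
  have huρ : (u : WithTop ℝ≥0) ≤ slePointLocTime κ z n ω := slePointClock_le_locTime t ω
  have huT := slePointClock_lt_swallowingTime hz t ω (κ := κ) (n := n)
  have hW := continuous_sleDriving κ ω
  -- the truncated time integral is the integral up to `u` of the untruncated drift along `x`
  have hint : timeIntegral (slePointReDrift κ z n) t ω = ∫ s in (0 : ℝ)..u,
      2 * (centredMap (sleDriving κ ω) s.toNNReal z).re / ‖centredMap (sleDriving κ ω) s.toNNReal z‖ ^ 2 := by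
    rw [slePointReDrift, timeIntegral_trunc]
    simp only [timeIntegral]
    refine intervalIntegral.integral_congr fun s hs ↦ ?_
    rw [uIcc_of_le u.coe_nonneg] at hs
    have hsρ := toNNReal_le_locTime_of_mem huρ hs
    simp only [slePointReStop_eq_of_le hsρ, norm_centredMap_sq_eq hz hsρ, slePointRe]
  rw [slePointReStop_apply, ← hu, slePointRe, hint, re_centredMap_eq hW hz huT]
  ring

/-- **`X` is an Itô process**: `X = x^{ρₙ}` is an Itô process driven by the canonical Brownian
motion for the raw filtration, with drift `𝟙_{s ≤ ρₙ} 2X_s/Q_s` and diffusion coefficient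
`𝟙_{s ≤ ρₙ}(-√κ)`: `X_t = re z + ∫₀ᵗ 𝟙 2X/Q ds + ∫₀ᵗ 𝟙(-√κ) dB`. Pathwise this is the integrated
Loewner equation (`slePointReStop_eq`); the stochastic term is the square-integrable Itô integral
of the truncated constant, indistinguishable from `-√κ B^{ρₙ}` (`IsItoIntegral.ae_eq_stoppedProcess`).
Rohde–Schramm (2005), p. 907: "`dxₜ = 2xₜ|zₜ|⁻² dt - dξ(t)`", localized.
[cite: RohdeSchramm2005, Lemma 6.5 (proof)] -/
theorem isItoProcess_slePointReStop (hz : 0 < z.im) :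
    IsItoProcess (slePointReStop κ z n) (slePointReDrift κ z n) (slePointDiffusion κ z n)
      brownian brownianFiltration preWienerMeasure := by
  haveI := isProbabilityMeasure_preWienerMeasure'
  have hρ' : ∀ t : ℝ≥0, MeasurableSet[brownianFiltration t] {ω | slePointLocTime κ z n ω < t} :=
    measurableSet_locTime_lt κ hz n
  refine ⟨ae_of_all _ fun ω t ↦ integrableOn_slePointReDrift hz ω t, ?_⟩
  -- the Itô integral of the truncated constant, a square-integrable martingale
  have hσ : IsStronglyProgressive brownianFiltration (slePointDiffusion κ z n) :=
    isStronglyProgressive_slePointDiffusion κ hz n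
  have hfin : ∀ t : ℝ≥0, ∫⁻ ω, (∫⁻ s in Set.Icc (0 : ℝ) t, ENNReal.ofReal
      (slePointDiffusion κ z n s.toNNReal ω ^ 2)) ∂preWienerMeasure ≠ ∞ := by
    intro t
    have hle : ∀ ω : ℝ≥0 → ℝ, (∫⁻ s in Set.Icc (0 : ℝ) t, ENNReal.ofReal
        (slePointDiffusion κ z n s.toNNReal ω ^ 2)) ≤ ENNReal.ofReal κ * volume (Set.Icc (0 : ℝ) t) := by
      intro ω
      rw [← setLIntegral_const]
      refine lintegral_mono fun s ↦ ENNReal.ofReal_le_ofReal ?_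
      have h := abs_slePointDiffusion_le (κ := κ) (z := z) (n := n) s.toNNReal ω
      have h2 : slePointDiffusion κ z n s.toNNReal ω ^ 2 ≤ Real.sqrt κ ^ 2 := by
        rw [← sq_abs]; exact pow_le_pow_left₀ (abs_nonneg _) h 2
      rwa [Real.sq_sqrt κ.coe_nonneg] at h2
    refine ne_top_of_le_ne_top ?_ (lintegral_mono hle)
    rw [lintegral_const, measure_univ, mul_one, Real.volume_Icc, sub_zero]
    exact ENNReal.mul_ne_top ENNReal.ofReal_ne_top ENNReal.ofReal_ne_top
  obtain ⟨J, hJ, -, -⟩ := exists_isItoIntegral_of_sq_integrable hσ hfin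
  have hJeq := IsItoIntegral.ae_eq_stoppedProcess martingale_brownian_holds
    martingale_brownian_sq_sub_holds memLp_two_brownian continuous_brownian
    (H := fun (_ : ℝ≥0) (_ : ℝ≥0 → ℝ) ↦ -Real.sqrt κ) measurable_const hρ'
    (isItoIntegral_const_brownian (-Real.sqrt κ)) hJ
  refine ⟨J, hJ, ?_⟩
  filter_upwards [hJeq] with ω hω t
  rw [hω t, slePointReStop_zero hz ω, slePointReStop_eq hz t ω]
  simp only [stoppedProcess, sleDriving, timeIntegral]
  ring

/-! ### `1/Y` in integrated form -/

/-- **`1/Y_t = 1/im z + ∫₀ᵗ 𝟙_{s ≤ ρₙ} 2/(Y_s Q_s) ds`** for every `ω` and `t`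
(`Loewner.inv_im_centredMap_eq` at the stopped clock). [cite: RohdeSchramm2005, Lemma 6.3 (proof)] -/
theorem inv_slePointImStop_eq (hz : 0 < z.im) (t : ℝ≥0) (ω : ℝ≥0 → ℝ) :
    (slePointImStop κ z n t ω)⁻¹ = (z.im)⁻¹ + timeIntegral (slePointInvImRate κ z n) t ω := by
  set u : ℝ≥0 := (min (t : WithTop ℝ≥0) (slePointLocTime κ z n ω)).untopA with hu
  have huρ : (u : WithTop ℝ≥0) ≤ slePointLocTime κ z n ω := slePointClock_le_locTime t ω
  have huT := slePointClock_lt_swallowingTime hz t ω (κ := κ) (n := n)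
  have hW := continuous_sleDriving κ ω
  have hint : timeIntegral (slePointInvImRate κ z n) t ω = ∫ s in (0 : ℝ)..u,
      2 / ((centredMap (sleDriving κ ω) s.toNNReal z).im *
        ‖centredMap (sleDriving κ ω) s.toNNReal z‖ ^ 2) := by
    rw [slePointInvImRate, timeIntegral_trunc]
    simp only [timeIntegral]
    refine intervalIntegral.integral_congr fun s hs ↦ ?_
    rw [uIcc_of_le u.coe_nonneg] at hs
    have hsρ := toNNReal_le_locTime_of_mem huρ hs
    simp only [slePointImStop_eq_of_le hsρ, norm_centredMap_sq_eq hz hsρ,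
      slePointIm_of_lt (coe_lt_swallowingTime_of_le_locTime hz hsρ)]
  rw [slePointImStop_apply, ← hu, slePointIm_of_lt huT, hint, inv_im_centredMap_eq hW hz huT]

/-! ### The factor `ψ^a` -/

variable (κ z n) in
/-- Rohde–Schramm's factor **`ψ_{t∧ρₙ}^a`** as the exponential of a time integral:
`slePointRatioPow κ z n a t ω = exp (a ∫₀ᵗ 𝟙_{s ≤ ρₙ} 4Y_s²/Q_s² ds)`; by (6.3) this is
`(derivRatio)^a` at the stopped clock (`slePointRatioPow_eq_rpow`). Written through the time
integral of a progressive process so that adaptedness is automatic.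
[cite: RohdeSchramm2005, Lemma 6.3 (proof)] -/
def slePointRatioPow (a : ℝ) (t : ℝ≥0) (ω : ℝ≥0 → ℝ) : ℝ :=
  Real.exp (a * timeIntegral (slePointRatioRate κ z n) t ω)

/-- The stopped clock of a time `v ≤ ρₙ` is `v`. [folklore] -/
theorem slePointClock_eq_of_le {ω : ℝ≥0 → ℝ} {v : ℝ≥0} (hv : (v : WithTop ℝ≥0) ≤ slePointLocTime κ z n ω) :
    ((min (v : WithTop ℝ≥0) (slePointLocTime κ z n ω)).untopA : ℝ≥0) = v := by
  rw [min_eq_left hv]; rfl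

/-- Before `ρₙ`, the (untruncated) ratio rate at a real time `s ∈ [0, u]` is Rohde–Schramm's rate
`derivRatioRate = 4yₛ²/|zₛ|⁴`. [folklore] -/
theorem slePointRatioRateU_toNNReal_eq (hz : 0 < z.im) {ω : ℝ≥0 → ℝ} {u : ℝ≥0}
    (hu : (u : WithTop ℝ≥0) ≤ slePointLocTime κ z n ω) {s : ℝ} (hs : s ∈ Icc (0 : ℝ) u) :
    4 * slePointImStop κ z n s.toNNReal ω ^ 2 / slePointNormSqStop κ z n s.toNNReal ω ^ 2 =
      derivRatioRate (sleDriving κ ω) z s := by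
  have hsρ := toNNReal_le_locTime_of_mem hu hs
  have hsT := coe_lt_swallowingTime_of_le_locTime hz hsρ
  rw [slePointImStop_eq_of_le hsρ, slePointIm_of_lt hsT, ← norm_centredMap_sq_eq hz hsρ,
    derivRatioRate_apply, centredMap_apply]
  ring

/-- Truncated version of `slePointRatioRateU_toNNReal_eq`. [folklore] -/
theorem slePointRatioRate_toNNReal_eq (hz : 0 < z.im) {ω : ℝ≥0 → ℝ} {u : ℝ≥0}
    (hu : (u : WithTop ℝ≥0) ≤ slePointLocTime κ z n ω) {s : ℝ} (hs : s ∈ Icc (0 : ℝ) u) :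
    slePointRatioRate κ z n s.toNNReal ω = derivRatioRate (sleDriving κ ω) z s := by
  rw [slePointRatioRate, trunc_of_le (toNNReal_le_locTime_of_mem hu hs)]
  exact slePointRatioRateU_toNNReal_eq hz hu hs

/-- The time integral of the ratio rate up to `t` is the one up to the stopped clock. [folklore] -/
theorem timeIntegral_slePointRatioRate_eq_clock (t : ℝ≥0) (ω : ℝ≥0 → ℝ) :
    timeIntegral (slePointRatioRate κ z n) t ω = timeIntegral (slePointRatioRate κ z n)
      ((min (t : WithTop ℝ≥0) (slePointLocTime κ z n ω)).untopA) ω := by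
  rw [slePointRatioRate, timeIntegral_trunc, timeIntegral_trunc,
    slePointClock_eq_of_le (slePointClock_le_locTime t ω)]

/-- The time integral of the ratio rate is `∫₀^{t∧ρₙ} derivRatioRate`. [folklore] -/
theorem timeIntegral_slePointRatioRate_eq (hz : 0 < z.im) (t : ℝ≥0) (ω : ℝ≥0 → ℝ) :
    timeIntegral (slePointRatioRate κ z n) t ω =
      ∫ s in (0 : ℝ)..((min (t : WithTop ℝ≥0) (slePointLocTime κ z n ω)).untopA : ℝ≥0),
        derivRatioRate (sleDriving κ ω) z s := by
  rw [timeIntegral_slePointRatioRate_eq_clock]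
  set u : ℝ≥0 := (min (t : WithTop ℝ≥0) (slePointLocTime κ z n ω)).untopA with hu
  have huρ : (u : WithTop ℝ≥0) ≤ slePointLocTime κ z n ω := slePointClock_le_locTime t ω
  simp only [timeIntegral]
  refine intervalIntegral.integral_congr fun s hs ↦ ?_
  rw [uIcc_of_le u.coe_nonneg] at hs
  exact slePointRatioRate_toNNReal_eq hz huρ hs

/-- **`ψ^a` at the stopped clock**: `slePointRatioPow κ z n a t ω = (derivRatio (√κ B(ω)) z (t ∧ ρₙ))^a`
(eq. (6.3), `Loewner.derivRatio_eq_exp`). [cite: RohdeSchramm2005, eq. (6.3)] -/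
theorem slePointRatioPow_eq_rpow (hz : 0 < z.im) (a : ℝ) (t : ℝ≥0) (ω : ℝ≥0 → ℝ) :
    slePointRatioPow κ z n a t ω =
      derivRatio (sleDriving κ ω) z ((min (t : WithTop ℝ≥0) (slePointLocTime κ z n ω)).untopA) ^ a := by
  rw [slePointRatioPow, timeIntegral_slePointRatioRate_eq hz, mul_comm, Real.exp_mul,
    ← derivRatio_eq_exp (continuous_sleDriving κ ω) hz (slePointClock_lt_swallowingTime hz t ω)]

/-- `ψ^a > 0`. [folklore] -/
theorem slePointRatioPow_pos (a : ℝ) (t : ℝ≥0) (ω : ℝ≥0 → ℝ) : 0 < slePointRatioPow κ z n a t ω :=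
  Real.exp_pos _

/-- The time integral of the ratio rate lies in `[0, 4((n+2)/im z)² (n+1)]`. [folklore] -/
theorem timeIntegral_slePointRatioRate_mem (hz : 0 < z.im) (t : ℝ≥0) (ω : ℝ≥0 → ℝ) :
    timeIntegral (slePointRatioRate κ z n) t ω ∈
      Icc (0 : ℝ) (4 * ((n + 2) / z.im) ^ 2 * (n + 1)) := by
  set u : ℝ≥0 := (min (t : WithTop ℝ≥0) (slePointLocTime κ z n ω)).untopA with hu
  have hule : (u : ℝ) ≤ n + 1 := by
    have h := (slePointClock_le_locTime (κ := κ) (z := z) (n := n) t ω).trans (slePointLocTime_le n ω)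
    rw [← hu] at h
    exact_mod_cast (WithTop.coe_le_coe.1 h)
  have heq : timeIntegral (slePointRatioRate κ z n) t ω =
      ∫ s in (0 : ℝ)..u, slePointRatioRate κ z n s.toNNReal ω := by
    rw [timeIntegral_slePointRatioRate_eq_clock]
    rfl
  rw [heq]
  constructor
  · exact intervalIntegral.integral_nonneg u.coe_nonneg fun s _ ↦ slePointRatioRate_nonneg _ _
  · have hfi : IntervalIntegrable (fun s : ℝ ↦ slePointRatioRate κ z n s.toNNReal ω) volume 0 u :=
      (intervalIntegrable_iff_integrableOn_Icc_of_le u.coe_nonneg).2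
        (integrableOn_slePointRatioRate hz ω u)
    have h1 : ∫ s in (0 : ℝ)..u, slePointRatioRate κ z n s.toNNReal ω ≤
        ∫ _ in (0 : ℝ)..u, 4 * ((n + 2) / z.im) ^ 2 :=
      intervalIntegral.integral_mono_on u.coe_nonneg hfi intervalIntegrable_const
        fun s _ ↦ slePointRatioRate_le hz _ _
    rw [intervalIntegral.integral_const, sub_zero, smul_eq_mul] at h1
    have hC : 0 ≤ 4 * ((n + 2 : ℝ) / z.im) ^ 2 := by positivity
    calc _ ≤ (u : ℝ) * (4 * ((n + 2) / z.im) ^ 2) := h1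
      _ ≤ (n + 1) * (4 * ((n + 2) / z.im) ^ 2) := mul_le_mul_of_nonneg_right hule hC
      _ = 4 * ((n + 2) / z.im) ^ 2 * (n + 1) := by ring

/-- **`1 ≤ ψ^a ≤ exp(a · 4((n+2)/im z)² (n+1))`** for `a ≥ 0`. [folklore] -/
theorem slePointRatioPow_mem (hz : 0 < z.im) {a : ℝ} (ha : 0 ≤ a) (t : ℝ≥0) (ω : ℝ≥0 → ℝ) :
    slePointRatioPow κ z n a t ω ∈ Icc (1 : ℝ) (Real.exp (a * (4 * ((n + 2) / z.im) ^ 2 * (n + 1)))) := by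
  obtain ⟨h0, h1⟩ := timeIntegral_slePointRatioRate_mem hz t ω (κ := κ) (n := n)
  refine ⟨?_, ?_⟩
  · rw [slePointRatioPow, ← Real.exp_zero]
    exact Real.exp_le_exp.2 (mul_nonneg ha h0)
  · exact Real.exp_le_exp.2 (mul_le_mul_of_nonneg_left h1 ha)

/-- `ψ^a` has continuous paths. [folklore] -/
theorem continuous_slePointRatioPow (hz : 0 < z.im) (a : ℝ) (ω : ℝ≥0 → ℝ) :
    Continuous fun t ↦ slePointRatioPow κ z n a t ω :=
  Real.continuous_exp.comp (continuous_const.mul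
    (continuous_timeIntegral fun t ↦ integrableOn_slePointRatioRate hz ω t))

/-- `ψ^a` is strongly adapted (time integral of a progressive process). [folklore] -/
theorem stronglyAdapted_slePointRatioPow (κ : ℝ≥0) (hz : 0 < z.im) (n : ℕ) (a : ℝ) :
    StronglyAdapted brownianFiltration (slePointRatioPow κ z n a) := fun t ↦
  (Real.continuous_exp.measurable.comp
    ((adapted_timeIntegral (isStronglyProgressive_slePointRatioRate κ hz n) t).const_mul a)).stronglyMeasurable

/-- `ψ^a` is progressive. [folklore] -/
theorem isStronglyProgressive_slePointRatioPow (κ : ℝ≥0) (hz : 0 < z.im) (n : ℕ) (a : ℝ) :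
    IsStronglyProgressive brownianFiltration (slePointRatioPow κ z n a) :=
  (stronglyAdapted_slePointRatioPow κ hz n a).isStronglyProgressive_of_continuous
    (continuous_slePointRatioPow hz a)

/-- The rate of `ψ^a`: `a · 𝟙 rate · ψ^a` is the truncation of the product with the untruncated
rate (the truncation indicator factors out). [folklore] -/
theorem ratioPowRate_eq_trunc (a : ℝ) :
    (fun s ω ↦ a * slePointRatioRate κ z n s ω * slePointRatioPow κ z n a s ω) =
      trunc (slePointLocTime κ z n) fun s ω ↦
        a * (4 * slePointImStop κ z n s ω ^ 2 / slePointNormSqStop κ z n s ω ^ 2) *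
          slePointRatioPow κ z n a s ω := by
  funext s ω
  rw [slePointRatioRate, trunc_apply, trunc_apply]
  split_ifs <;> simp

/-- **`ψ^a_t = 1 + ∫₀ᵗ a · rateₛ · ψ^a_s ds`** for every `ω` and `t` (`Loewner.derivRatio_rpow_eq` at
the stopped clock, read through `slePointRatioPow_eq_rpow`). [cite: RohdeSchramm2005, eq. (6.3)] -/
theorem slePointRatioPow_eq_one_add (hz : 0 < z.im) (a : ℝ) (t : ℝ≥0) (ω : ℝ≥0 → ℝ) :
    slePointRatioPow κ z n a t ω = 1 + timeIntegral
      (fun s ω ↦ a * slePointRatioRate κ z n s ω * slePointRatioPow κ z n a s ω) t ω := by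
  set u : ℝ≥0 := (min (t : WithTop ℝ≥0) (slePointLocTime κ z n ω)).untopA with hu
  have huρ : (u : WithTop ℝ≥0) ≤ slePointLocTime κ z n ω := slePointClock_le_locTime t ω
  have huT := slePointClock_lt_swallowingTime hz t ω (κ := κ) (n := n)
  have hW := continuous_sleDriving κ ω
  rw [slePointRatioPow_eq_rpow hz, ← hu, derivRatio_rpow_eq hW hz a huT, ratioPowRate_eq_trunc,
    timeIntegral_trunc, ← hu]
  congr 1
  simp only [timeIntegral]
  refine intervalIntegral.integral_congr fun s hs ↦ ?_
  rw [uIcc_of_le u.coe_nonneg] at hs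
  have hsρ := toNNReal_le_locTime_of_mem huρ hs
  have h1 := slePointRatioRateU_toNNReal_eq hz huρ hs
  simp only [h1, slePointRatioPow_eq_rpow hz, slePointClock_eq_of_le hsρ]

end Literature.Probability.RandomPlanarGeometry
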